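import Literature.MathematicalPhysics.QuantumFieldTheory.ConformalBootstrap3D.PointKernelK34v2Data

/-!
# K34v2 certificate, kernel block file H14: head segments `230 ≤ i < 236` (block-checked ones)

`decide` by kernel reduction (no `native_decide`, no extra axioms) of the block checker
`PCert.hBlockOK` of `PointKernel` on the literal data of `PointKernelK34v2Data` (cells checked corner
or chord by the rule bit); soundness is `PCert.hBlockOK_sound`.  Estimated kernel time 226 s
(6 theorems).
-/

set_option maxRecDepth 100000
set_option maxHeartbeats 0

namespace Literature.MathematicalPhysics.QuantumFieldTheory.ConformalBootstrap3D.PointKernelK34v2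

open Literature.MathematicalPhysics.QuantumFieldTheory.ConformalBootstrap3D.PointKernel

/-- head segment `[230, 231)` passes the kernel evaluator (≈33 s of kernel work). [folklore] -/
theorem hBlock_230 : certK34v2.hBlockOK hsegsK34v2 230 231 JHK34v2 = true := by
  decide +kernel

/-- head segment `[231, 232)` passes the kernel evaluator (≈33 s of kernel work). [folklore] -/
theorem hBlock_231 : certK34v2.hBlockOK hsegsK34v2 231 232 JHK34v2 = true := by
  decide +kernel

/-- head segment `[232, 233)` passes the kernel evaluator (≈40 s of kernel work). [folklore] -/
theorem hBlock_232 : certK34v2.hBlockOK hsegsK34v2 232 233 JHK34v2 = true := by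
  decide +kernel

/-- head segment `[233, 234)` passes the kernel evaluator (≈23 s of kernel work). [folklore] -/
theorem hBlock_233 : certK34v2.hBlockOK hsegsK34v2 233 234 JHK34v2 = true := by
  decide +kernel

/-- head segment `[234, 235)` passes the kernel evaluator (≈40 s of kernel work). [folklore] -/
theorem hBlock_234 : certK34v2.hBlockOK hsegsK34v2 234 235 JHK34v2 = true := by
  decide +kernel

/-- head segment `[235, 236)` passes the kernel evaluator (≈33 s of kernel work). [folklore] -/
theorem hBlock_235 : certK34v2.hBlockOK hsegsK34v2 235 236 JHK34v2 = true := by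
  decide +kernel

end Literature.MathematicalPhysics.QuantumFieldTheory.ConformalBootstrap3D.PointKernelK34v2
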